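import Literature.Computability.AlgebraicComplexity.SubgroupTPPAbelianPrimeIndex
import Literature.Computability.AlgebraicComplexity.SubgroupTPPQuotient
import Literature.RepresentationTheory.FiniteGroups.PCubedCharacterDegrees
import HarnessLib

/-!
# `p`-groups of order `≤ p⁴` have no non-trivial subgroup TPP triple (Murthy 2026, Prop. 2.14)

Topic `Literature/Computability/AlgebraicComplexity` (group-theoretic matrix multiplication: subgroup
TPP triples, the tree's `DihedralSubgroups.SubgroupTPP`; companion of
`SubgroupTPPAbelianPrimeIndex.lean` (Murthy 2025, Thm. 4.1 / Cor. 4.3) and `SubgroupTPPQuotient.lean`).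

S. R. Murthy, *On the triple product property for subgroups of finite nilpotent groups of class 2*,
arXiv:2602.15796v1 (2026), p. 10, verbatim (`ρ₀(G)` = the largest `|S||T||U|/|G|` over subgroup TPP
triples of `G`):

> **Proposition 2.14.** If `G` is a `p`-group of order `≤ p⁴` then `ρ₀(G) = 1`.
> *Proof.* All `p`-groups of order `≤ p²` are abelian and realise `ρ₀ = ρ = 1`. For nonabelian
> `p`-groups of order `p³` and `p⁴` the result follows from combinatorial constraints on parameters of
> TPP triples imposed by the inequalities in [10, Observation 3.1] […]. Some simple group-theoretic
> arguments also exist here. Nonabelian `p`-groups of order `p³`, which are extraspecial, and those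
> of order `p⁴`, contain abelian (and normal) subgroups of index `p` (see [5, Lemma 3.4] for
> `p`-groups of order `p³`, and for `p`-groups of order `p⁴` see [12, Lemma 2] for `p = 2`, and
> [1, Proposition 12] for `p > 2`). So for these groups `ρ₀ = 1` by [9, Corollary 4.3].

([9, Corollary 4.3] = Murthy 2025, Cor. 4.3 (2), tree `Murthy2025_cor43_2`: a group of order `pⁿ`
with an abelian normal subgroup of index `p` has `ρ₀ = 1`.)

## What is here (all proved; 0 definitions, 0 named facts)

The second ("group-theoretic") printed argument, made self-contained (the existence of the abelian
normal subgroup of index `p` is proved here by elementary counting, uniformly in `p`, instead of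
being quoted from [5], [12], [1]):

* `Murthy2026.exists_abelian_normal_index_p_of_index_center` — if `[G : Z(G)] = p²` then `G` has an
  abelian normal subgroup of index `p`: the preimage `H` of a subgroup of order `p` of the abelian
  group `G/Z(G)`, abelian because `H/(H ∩ Z(G))` is cyclic with `H ∩ Z(G)` central;
* `Murthy2026.exists_abelian_normal_index_p_of_card_pcubed` — a non-abelian group of order `p³` has
  an abelian normal subgroup of index `p` (`[G : Z(G)] = p²`, tree `PCubed.index_center`);
* `Murthy2026.exists_abelian_normal_index_p_of_card_pfour` — the same for order `p⁴`: `|Z(G)| = p²`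
  is the previous case; if `|Z(G)| = p`, take `n ∉ Z(G)` central modulo `Z(G)`; `g ↦ [g, n]` is a
  homomorphism `G → Z(G)` whose kernel `C_G(n)` has index `p` and is abelian, because its centre
  contains `⟨Z(G), n⟩` of order `> p` whereas a non-abelian group of order `p³` has centre of order
  `p` (tree `PCubed.card_center`);
* `Murthy2026_prop214_le_psq`, `Murthy2026_prop214_pcubed`, `Murthy2026_prop214_pfour` — Prop. 2.14
  for the orders `pⁿ` with `n ≤ 2` (abelian groups: every subgroup is normal,
  `Murthy2026_prop26_2_subgroup`), `p³` and `p⁴` (non-abelian case: the items above and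
  `Murthy2025_cor43_2`);
* `Murthy2026_prop214` — **Prop. 2.14 as printed**: `|G| = pⁿ`, `n ≤ 4` ⇒ every subgroup TPP triple
  `(S, T, U)` has `|S| |T| |U| ≤ |G|`.
* `Murthy2026.exists_abelian_normal_index_p_of_cyclic_quot`, `Murthy2026_prop217_1`,
  `Murthy2026_prop217_2_cyclic` — **Prop. 2.17 (1)** (`[G : Z(G)] = p²` ⇒ an abelian normal subgroup
  of index `p`) and the case `G/Z(G) ≅ C_{p²} × C_p` of **Prop. 2.17 (2)** (`G/Z(G)` abelian of order
  `p³` with an element of order `p²` ⇒ the same); the printed case `G/Z(G) ≅ C_p³` of Prop. 2.17 (2)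
  is false (tree `Murthy2026_prop217_2_false`, `Literature/GroupTheory/SpecificGroups/SpecialClassTwoP6.lean`);
* `Murthy2026_thm51_index_psq`, `Murthy2026_thm51_index_pcubed_cyclic` — the parts of **Thm. 5.1**
  ("`p`-group of class `2` with `p² ≤ [G : Z(G)] ≤ p³` ⇒ `ρ₀(G) = 1`", p. 16) whose printed proof
  (Prop. 2.17 + [9, Cor. 4.3]) is valid: `[G : Z(G)] = p²` (any order `pⁿ`), and `[G : Z(G)] = p³`
  with `G/Z(G) ≅ C_{p²} × C_p`; the case `G/Z(G) ≅ C_p³` is not decided here.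

Census reading (pub-omega, family (b), SUBGROUP triples): for EVERY prime `p`, no group of order
`p`, `p²`, `p³` or `p⁴` carries a non-trivial subgroup TPP triple — a kernel 'bound reached' line for
the orders `8, 16, 27, 81, 125, 625, …` that needs no enumeration.
Likewise no `p`-group whose centre has index `p²` (e.g. `D₈ × A`, `Q₈ × A`, `p^{1+2} × A` with `A`
an abelian `p`-group) carries one (`Murthy2026_thm51_index_psq`).

## References
* S. R. Murthy, arXiv:2602.15796v1 (2026): Prop. 2.14 with proof, p. 10; Prop. 2.17, p. 11; Thm. 5.1,
  p. 16. [Murthy2026]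
* S. R. Murthy, arXiv:2512.16730 (2025): Cor. 4.3 (2). [Murthy2025TPPIndexP]
* G. James, M. Liebeck, *Representations and Characters of Groups*, 2nd ed. (2001), Ch. 26, p. 301
  (`|Z(G)| = p`, `G/Z(G) ≅ C_p × C_p` for non-abelian `|G| = p³`). [JamesLiebeck2001]
-/

namespace Literature.Computability.AlgebraicComplexity

open DihedralSubgroups Literature.RepresentationTheory.FiniteGroups

variable {G : Type} [Group G] [Finite G] {p : ℕ} [hp : Fact p.Prime]

namespace Murthy2026

/-- If the centre of a finite group has index `p²` (`p` prime), the group has an abelian normal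
subgroup of index `p`: the preimage `H` of a subgroup of order `p` of the abelian group `G/Z(G)`
(normal because `G/Z(G)` is abelian; abelian because `H/(H ∩ Z(G))` is cyclic with `H ∩ Z(G)`
central). [folklore] (the step behind "Nonabelian `p`-groups of order `p³` … contain abelian (and
normal) subgroups of index `p`", [cite: Murthy2026, Prop. 2.14 (proof)]) -/
theorem exists_abelian_normal_index_p_of_index_center
    (hZi : (Subgroup.center G).index = p ^ 2) :
    ∃ H : Subgroup G, H.Normal ∧ IsMulCommutative H ∧ H.index = p := by
  have hpp := hp.out
  set Z := Subgroup.center G with hZ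
  -- `G/Z` has order `p²`, hence is abelian
  have hcardQ : Nat.card (G ⧸ Z) = p ^ 2 := by rw [← Subgroup.index_eq_card, hZi]
  have hQcomm : ∀ a b : G ⧸ Z, a * b = b * a := fun a b =>
    (IsPGroup.isMulCommutative_of_card_eq_prime_sq hcardQ).is_comm.comm a b
  -- a subgroup `K` of order `p` (index `p`) of `G/Z`, normal since `G/Z` is abelian
  obtain ⟨x, hx⟩ := exists_prime_orderOf_dvd_card' (G := G ⧸ Z) p
    (by rw [hcardQ]; exact dvd_pow_self p two_ne_zero)
  set K := Subgroup.zpowers x with hK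
  have hKcard : Nat.card K = p := by rw [hK, Nat.card_zpowers, hx]
  have hKi : K.index = p := by
    have h := K.card_mul_index
    rw [hKcard, hcardQ, pow_two] at h
    exact Nat.eq_of_mul_eq_mul_left hpp.pos h
  have hKn : K.Normal := ⟨fun a ha b => by rw [hQcomm b a, mul_inv_cancel_right]; exact ha⟩
  -- its preimage `H`
  let f : G →* G ⧸ Z := QuotientGroup.mk' Z
  set H := K.comap f with hH
  have hHi : H.index = p := by
    rw [hH, K.index_comap_of_surjective (QuotientGroup.mk'_surjective Z), hKi]
  have hHn : H.Normal := hKn.comap f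
  -- `H` is abelian: `H → K` has kernel `H ∩ Z`, central in `H`, and `K` is cyclic
  have hHc : IsMulCommutative H := by
    let g : H →* K := (f.comp H.subtype).codRestrict K fun h => by
      show f (h : G) ∈ K
      exact h.2
    refine g.isMulCommutative_of_isCyclic_of_ker_le_center fun h hh => ?_
    rw [MonoidHom.mem_ker] at hh
    have hfh : f (h : G) = 1 := congrArg Subtype.val hh
    have hz : (h : G) ∈ Z := (QuotientGroup.eq_one_iff (h : G)).1 hfh
    rw [Subgroup.mem_center_iff]
    intro k
    exact Subtype.ext ((Subgroup.mem_center_iff.1 hz) k)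
  exact ⟨H, hHn, hHc, hHi⟩

/-- **A non-abelian group of order `p³` has an abelian normal subgroup of index `p`** ("Nonabelian
`p`-groups of order `p³`, which are extraspecial, … contain abelian (and normal) subgroups of index
`p`"): its centre has index `p²` (tree `PCubed.index_center`). [cite: Murthy2026, Prop. 2.14 (proof)]
[cite: JamesLiebeck2001, Ch. 26 p. 301] -/
theorem exists_abelian_normal_index_p_of_card_pcubed (hG : Nat.card G = p ^ 3)
    (hna : ∃ a b : G, a * b ≠ b * a) :
    ∃ H : Subgroup G, H.Normal ∧ IsMulCommutative H ∧ H.index = p :=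
  exists_abelian_normal_index_p_of_index_center (PCubed.index_center hG hna)

/-- **A non-abelian group of order `p⁴` has an abelian normal subgroup of index `p`** ("those of
order `p⁴`, contain abelian (and normal) subgroups of index `p` (… see [12, Lemma 2] for `p = 2`, and
[1, Proposition 12] for `p > 2`)").  Proof (elementary, uniform in `p`): `|Z(G)| ∈ {p, p²}`; if
`|Z(G)| = p²` use `exists_abelian_normal_index_p_of_index_center`; if `|Z(G)| = p`, pick `n ∉ Z(G)`
whose image in `G/Z(G)` is central — then `g ↦ [g, n]` is a homomorphism `G → Z(G)`, its kernel
`C = C_G(n)` has index `p`, and `C` is abelian since `Z(C) ⊇ ⟨Z(G), n⟩` has order `> p` while a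
non-abelian group of order `p³` has centre of order `p` (`PCubed.card_center`).
[cite: Murthy2026, Prop. 2.14 (proof)] -/
theorem exists_abelian_normal_index_p_of_card_pfour (hG : Nat.card G = p ^ 4)
    (hna : ∃ a b : G, a * b ≠ b * a) :
    ∃ H : Subgroup G, H.Normal ∧ IsMulCommutative H ∧ H.index = p := by
  have hpp := hp.out
  have hPG : IsPGroup p G := IsPGroup.of_card hG
  haveI : Nontrivial G := by
    rw [← Finite.one_lt_card_iff_nontrivial, hG]
    exact Nat.one_lt_pow (by norm_num) hpp.one_lt
  set Z := Subgroup.center G with hZ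
  haveI : Nontrivial Z := hPG.center_nontrivial
  obtain ⟨m, hm, hZc⟩ := (Nat.dvd_prime_pow hpp).1 (hG ▸ Z.card_subgroup_dvd_card)
  have hidx : Nat.card Z * Z.index = p ^ 4 := by rw [Subgroup.card_mul_index, hG]
  -- `G` non-abelian: `Z ≠ G` and `G/Z` is not cyclic of prime order
  have hZtop : Z ≠ ⊤ := fun htop => by
    obtain ⟨a, b, hab⟩ := hna
    have hb : b ∈ Z := by rw [htop]; exact Subgroup.mem_top b
    exact hab (Subgroup.mem_center_iff.1 hb a)
  have hZi_ne : Z.index ≠ p := fun hi => by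
    haveI : IsCyclic (G ⧸ Z) :=
      isCyclic_of_prime_card (p := p) (by rw [← Subgroup.index_eq_card]; exact hi)
    have hcomm := (QuotientGroup.mk' Z).isMulCommutative_of_isCyclic_of_ker_le_center
      (by rw [QuotientGroup.ker_mk'])
    obtain ⟨a, b, hab⟩ := hna
    exact hab (hcomm.is_comm.comm a b)
  interval_cases m
  · -- `|Z| = 1`: impossible
    exfalso
    have h1 : 1 < Nat.card Z := Finite.one_lt_card
    rw [hZc, pow_zero] at h1
    exact lt_irrefl _ h1
  · -- `|Z| = p`, `|G/Z| = p³`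
    rw [pow_one] at hZc
    have hZi : Z.index = p ^ 3 := by
      rw [hZc] at hidx
      have h4 : p ^ 4 = p * p ^ 3 := by ring
      rw [h4] at hidx
      exact Nat.eq_of_mul_eq_mul_left hpp.pos hidx
    have hcardQ : Nat.card (G ⧸ Z) = p ^ 3 := by rw [← Subgroup.index_eq_card, hZi]
    haveI : Nontrivial (G ⧸ Z) := by
      rw [← Finite.one_lt_card_iff_nontrivial, hcardQ]
      exact Nat.one_lt_pow (by norm_num) hpp.one_lt
    haveI : Nontrivial (Subgroup.center (G ⧸ Z)) := (hPG.to_quotient Z).center_nontrivial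
    -- a non-trivial central element `c` of `G/Z` and a preimage `n ∉ Z`
    obtain ⟨⟨c, hc⟩, hc1⟩ := exists_ne (1 : Subgroup.center (G ⧸ Z))
    have hc1' : c ≠ 1 := fun h => hc1 (Subtype.ext h)
    obtain ⟨n, hn⟩ := QuotientGroup.mk'_surjective Z c
    have hnZ : n ∉ Z := fun h => hc1' (by rw [← hn]; exact (QuotientGroup.eq_one_iff n).2 h)
    -- every commutator `[g, n]` lies in `Z`
    have hcommZ : ∀ g : G, g * n * g⁻¹ * n⁻¹ ∈ Z := fun g => by
      rw [← QuotientGroup.eq_one_iff, ← QuotientGroup.mk'_apply Z, map_mul, map_mul, map_mul, map_inv,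
        map_inv, hn, (Subgroup.mem_center_iff.1 hc (QuotientGroup.mk' Z g)), mul_inv_cancel_right,
        mul_inv_cancel]
    -- the homomorphism `g ↦ [g, n]`
    let φ : G →* G := MonoidHom.mk' (fun g => g * n * g⁻¹ * n⁻¹) fun a b => by
      have hcb := Subgroup.mem_center_iff.1 (hcommZ b)
      show a * b * n * (a * b)⁻¹ * n⁻¹ = a * n * a⁻¹ * n⁻¹ * (b * n * b⁻¹ * n⁻¹)
      calc a * b * n * (a * b)⁻¹ * n⁻¹ = a * (b * n * b⁻¹ * n⁻¹) * n * a⁻¹ * n⁻¹ := by group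
        _ = (b * n * b⁻¹ * n⁻¹) * a * n * a⁻¹ * n⁻¹ := by rw [hcb a]
        _ = (b * n * b⁻¹ * n⁻¹) * (a * n * a⁻¹ * n⁻¹) := by group
        _ = a * n * a⁻¹ * n⁻¹ * (b * n * b⁻¹ * n⁻¹) := (hcb _).symm
    have hφ : ∀ g, φ g = g * n * g⁻¹ * n⁻¹ := fun g => rfl
    have hmemker : ∀ g, g ∈ φ.ker ↔ g * n = n * g := fun g => by
      rw [MonoidHom.mem_ker, hφ, mul_inv_eq_one, mul_inv_eq_iff_eq_mul]
    set H := φ.ker with hH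
    -- `[G : H] = |φ(G)|` divides `|Z| = p`, and is not `1` since `n ∉ Z`
    have hrange : φ.range ≤ Z := by
      rintro x ⟨g, rfl⟩
      exact hcommZ g
    have hHi_dvd : H.index ∣ p := by
      rw [hH, Subgroup.index_ker, ← hZc]
      exact Subgroup.card_dvd_of_le hrange
    have hHi : H.index = p := by
      rcases (Nat.dvd_prime hpp).1 hHi_dvd with h1 | h1
      · exfalso
        apply hnZ
        rw [Subgroup.mem_center_iff]
        intro g
        have hg : g ∈ H := by rw [Subgroup.index_eq_one.1 h1]; exact Subgroup.mem_top g
        exact (hmemker g).1 hg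
      · exact h1
    have hHcard : Nat.card H = p ^ 3 := by
      have h := H.card_mul_index
      rw [hHi, hG, show p ^ 4 = p ^ 3 * p by ring] at h
      exact Nat.eq_of_mul_eq_mul_right hpp.pos h
    have hZH : Z ≤ H := fun z hz => (hmemker z).2 (Subgroup.mem_center_iff.1 hz n).symm
    have hnH : n ∈ H := (hmemker n).2 rfl
    -- `H` is abelian
    have hHc : IsMulCommutative H := by
      by_cases hHab : ∃ a b : H, a * b ≠ b * a
      · exfalso
        have hcH : Nat.card (Subgroup.center H) = p := PCubed.card_center hHcard hHab
        -- `Z` (as a subgroup of `H`) lies in `Z(H)` and has the same order, so equals it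
        have hle : Z.subgroupOf H ≤ Subgroup.center H := fun z hz => by
          rw [Subgroup.mem_subgroupOf] at hz
          rw [Subgroup.mem_center_iff]
          intro k
          exact Subtype.ext (Subgroup.mem_center_iff.1 hz k)
        have hZHcard : Nat.card (Z.subgroupOf H) = p := by
          rw [Nat.card_congr (Subgroup.subgroupOfEquivOfLe hZH).toEquiv, hZc]
        have heq : Z.subgroupOf H = Subgroup.center H :=
          Subgroup.eq_of_le_of_card_ge hle (by rw [hcH, hZHcard])
        -- but `n ∈ Z(H)` and `n ∉ Z`
        have hnc : (⟨n, hnH⟩ : H) ∈ Subgroup.center H := by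
          rw [Subgroup.mem_center_iff]
          intro k
          exact Subtype.ext ((hmemker k).1 k.2)
        rw [← heq, Subgroup.mem_subgroupOf] at hnc
        exact hnZ hnc
      · exact ⟨⟨fun a b => by
          by_contra hc
          exact hHab ⟨a, b, hc⟩⟩⟩
    exact ⟨H, inferInstance, hHc, hHi⟩
  · -- `|Z| = p²`, `[G : Z] = p²`
    have hZi : Z.index = p ^ 2 := by
      rw [hZc] at hidx
      have h4 : p ^ 4 = p ^ 2 * p ^ 2 := by ring
      rw [h4] at hidx
      exact Nat.eq_of_mul_eq_mul_left (pow_pos hpp.pos 2) hidx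
    exact exists_abelian_normal_index_p_of_index_center hZi
  · -- `|Z| = p³`: `G/Z` cyclic of order `p`, impossible
    exfalso
    apply hZi_ne
    rw [hZc] at hidx
    have h4 : p ^ 4 = p ^ 3 * p := by ring
    rw [h4] at hidx
    exact Nat.eq_of_mul_eq_mul_left (pow_pos hpp.pos 3) hidx
  · -- `|Z| = p⁴`: `Z = G`, impossible
    exfalso
    exact hZtop (Subgroup.eq_top_of_card_eq _ (by rw [hZc, hG]))

end Murthy2026

/-- **Murthy 2026, Prop. 2.14, for `|G| = p³`**: every subgroup TPP triple `(S, T, U)` of a group of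
order `p³` is trivial, `|S| |T| |U| ≤ |G|` — i.e. `ρ₀(G) = 1` ("for these groups `ρ₀ = 1` by
[9, Corollary 4.3]"; abelian `G`: every member is normal). [cite: Murthy2026, Prop. 2.14]
[cite: Murthy2025TPPIndexP, Cor. 4.3 (2)] -/
theorem Murthy2026_prop214_pcubed (hG : Nat.card G = p ^ 3) {S T U : Subgroup G}
    (h : SubgroupTPP S T U) : Nat.card S * Nat.card T * Nat.card U ≤ Nat.card G := by
  by_cases hab : ∃ a b : G, a * b ≠ b * a
  · obtain ⟨H, hHn, hHc, hHi⟩ := Murthy2026.exists_abelian_normal_index_p_of_card_pcubed hG hab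
    haveI := hHn; haveI := hHc
    exact Murthy2025_cor43_2 H hp.out hHi hG h
  · have hab' : ∀ a b : G, a * b = b * a := fun a b => by
      by_contra hc
      exact hab ⟨a, b, hc⟩
    haveI : S.Normal := ⟨fun n hn g => by rwa [hab' g n, mul_inv_cancel_right]⟩
    exact Murthy2026_prop26_2_subgroup h

/-- **Murthy 2026, Prop. 2.14, for `|G| = p` or `p²`**: such groups are abelian, so every subgroup TPP
triple is trivial ("All `p`-groups of order `≤ p²` are abelian and realise `ρ₀ = ρ = 1`").
[cite: Murthy2026, Prop. 2.14] -/
theorem Murthy2026_prop214_le_psq {n : ℕ} (hn : n ≤ 2) (hG : Nat.card G = p ^ n)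
    {S T U : Subgroup G} (h : SubgroupTPP S T U) :
    Nat.card S * Nat.card T * Nat.card U ≤ Nat.card G := by
  -- groups of order `p^n`, `n ≤ 2`, are abelian
  have hcomm : ∀ a b : G, a * b = b * a := by
    have hPG : IsPGroup p G := IsPGroup.of_card hG
    interval_cases n
    · -- order 1
      intro a b
      haveI : Subsingleton G := (Nat.card_eq_one_iff_unique.1 (by rw [hG, pow_zero])).1
      exact Subsingleton.elim _ _
    · -- order p: cyclic
      haveI : IsCyclic G := isCyclic_of_prime_card (p := p) (by rw [hG, pow_one])
      exact fun a b => IsCyclic.commGroup.mul_comm a b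
    · -- order p²
      exact fun a b => (IsPGroup.isMulCommutative_of_card_eq_prime_sq hG).is_comm.comm a b
  haveI : S.Normal := ⟨fun m hm g => by rwa [hcomm g m, mul_inv_cancel_right]⟩
  exact Murthy2026_prop26_2_subgroup h

/-- **Murthy 2026, Prop. 2.14, for `|G| = p⁴`**: every subgroup TPP triple of a group of order `p⁴`
is trivial, `|S| |T| |U| ≤ |G|` (non-abelian case: an abelian normal subgroup of index `p` and
[9, Corollary 4.3]; abelian case: every member is normal). [cite: Murthy2026, Prop. 2.14]
[cite: Murthy2025TPPIndexP, Cor. 4.3 (2)] -/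
theorem Murthy2026_prop214_pfour (hG : Nat.card G = p ^ 4) {S T U : Subgroup G}
    (h : SubgroupTPP S T U) : Nat.card S * Nat.card T * Nat.card U ≤ Nat.card G := by
  by_cases hab : ∃ a b : G, a * b ≠ b * a
  · obtain ⟨H, hHn, hHc, hHi⟩ := Murthy2026.exists_abelian_normal_index_p_of_card_pfour hG hab
    haveI := hHn; haveI := hHc
    exact Murthy2025_cor43_2 H hp.out hHi hG h
  · have hab' : ∀ a b : G, a * b = b * a := fun a b => by
      by_contra hc
      exact hab ⟨a, b, hc⟩
    haveI : S.Normal := ⟨fun n hn g => by rwa [hab' g n, mul_inv_cancel_right]⟩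
    exact Murthy2026_prop26_2_subgroup h

/-- **Murthy 2026, Prop. 2.14** ("If `G` is a `p`-group of order `≤ p⁴` then `ρ₀(G) = 1`"): for a
prime `p` and `n ≤ 4`, every subgroup TPP triple `(S, T, U)` of a group of order `pⁿ` satisfies
`|S| |T| |U| ≤ |G|`. [cite: Murthy2026, Prop. 2.14] -/
theorem Murthy2026_prop214 {n : ℕ} (hn : n ≤ 4) (hG : Nat.card G = p ^ n)
    {S T U : Subgroup G} (h : SubgroupTPP S T U) :
    Nat.card S * Nat.card T * Nat.card U ≤ Nat.card G := by
  rcases Nat.lt_or_ge n 3 with h3 | h3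
  · exact Murthy2026_prop214_le_psq (by omega) hG h
  · rcases Nat.lt_or_ge n 4 with h4 | h4
    · have : n = 3 := by omega
      subst this
      exact Murthy2026_prop214_pcubed hG h
    · have : n = 4 := by omega
      subst this
      exact Murthy2026_prop214_pfour hG h

namespace Murthy2026

omit [Finite G] hp in
/-- If `G/Z(G)` has a cyclic normal subgroup `K` of index `p`, then `G` has an abelian normal subgroup
of index `p`: the preimage of `K` (normal as the preimage of a normal subgroup; abelian because it is
cyclic modulo the central subgroup `Z(G)`) — the Correspondence-Theorem step of the printed proof of
Prop. 2.17. [folklore] [cite: Murthy2026, Prop. 2.17 (proof)] -/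
theorem exists_abelian_normal_index_p_of_cyclic_quot (K : Subgroup (G ⧸ Subgroup.center G))
    [hKn : K.Normal] [IsCyclic K] (hKi : K.index = p) :
    ∃ H : Subgroup G, H.Normal ∧ IsMulCommutative H ∧ H.index = p := by
  let f : G →* G ⧸ Subgroup.center G := QuotientGroup.mk' (Subgroup.center G)
  set H := K.comap f with hH
  have hHi : H.index = p := by
    rw [hH, K.index_comap_of_surjective (QuotientGroup.mk'_surjective _), hKi]
  have hHn : H.Normal := hKn.comap f
  have hHc : IsMulCommutative H := by
    let g : H →* K := (f.comp H.subtype).codRestrict K fun h => by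
      show f (h : G) ∈ K
      exact h.2
    refine g.isMulCommutative_of_isCyclic_of_ker_le_center fun h hh => ?_
    rw [MonoidHom.mem_ker] at hh
    have hfh : f (h : G) = 1 := congrArg Subtype.val hh
    have hz : (h : G) ∈ Subgroup.center G := (QuotientGroup.eq_one_iff (h : G)).1 hfh
    rw [Subgroup.mem_center_iff]
    intro k
    exact Subtype.ext ((Subgroup.mem_center_iff.1 hz) k)
  exact ⟨H, hHn, hHc, hHi⟩

end Murthy2026

/-- **Murthy 2026, Prop. 2.17 (1)** ("If `G` is a `p`-group such that `G/Z(G)` is elementary abelian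
of order `p²` … then `G` contains abelian (maximal, normal) subgroups of index `p`"): if `Z(G)` has
index `p²` then `G` has an abelian normal subgroup of index `p` (for any finite group; `G/Z(G)` of
order `p²` is automatically elementary abelian, Lemma 2.16). [cite: Murthy2026, Prop. 2.17 (1)] -/
theorem Murthy2026_prop217_1 (hZi : (Subgroup.center G).index = p ^ 2) :
    ∃ H : Subgroup G, H.Normal ∧ IsMulCommutative H ∧ H.index = p :=
  Murthy2026.exists_abelian_normal_index_p_of_index_center hZi

omit [Finite G] in
/-- **Murthy 2026, Prop. 2.17 (2), the case `G/Z(G) ≅ C_{p²} × C_p`** ("If `G/Z(G) ≅ C_{p²} × C_p`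
then `G` contains an abelian maximal normal subgroup `K` of index `p` corresponding to an abelian
maximal normal subgroup `L` of `G/Z(G)` of index `p` where `L` is isomorphic to `C_{p²}`"): if
`G/Z(G)` is abelian of order `p³` with an element of order `p²`, then `G` has an abelian normal
subgroup of index `p`.  (The other printed case, `G/Z(G) ≅ C_p × C_p × C_p`, is FALSE — tree
`Murthy2026_prop217_2_false`, `Literature/GroupTheory/SpecificGroups/SpecialClassTwoP6.lean`.)
[cite: Murthy2026, Prop. 2.17 (2)] -/
theorem Murthy2026_prop217_2_cyclic (hZi : (Subgroup.center G).index = p ^ 3)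
    (hQc : ∀ a b : G ⧸ Subgroup.center G, a * b = b * a)
    (hx : ∃ x : G ⧸ Subgroup.center G, orderOf x = p ^ 2) :
    ∃ H : Subgroup G, H.Normal ∧ IsMulCommutative H ∧ H.index = p := by
  have hpp := hp.out
  obtain ⟨x, hx⟩ := hx
  have hcardQ : Nat.card (G ⧸ Subgroup.center G) = p ^ 3 := by rw [← Subgroup.index_eq_card, hZi]
  set K := Subgroup.zpowers x with hK
  have hKcard : Nat.card K = p ^ 2 := by rw [hK, Nat.card_zpowers, hx]
  have hKi : K.index = p := by
    have h := K.card_mul_index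
    have h3 : p ^ 3 = p ^ 2 * p := by ring
    rw [hKcard, hcardQ, h3] at h
    exact Nat.eq_of_mul_eq_mul_left (pow_pos hpp.pos 2) h
  haveI : K.Normal := ⟨fun a ha b => by rw [hQc b a, mul_inv_cancel_right]; exact ha⟩
  exact Murthy2026.exists_abelian_normal_index_p_of_cyclic_quot K hKi

/-- **Murthy 2026, Thm. 5.1, the case `[G : Z(G)] = p²`** ("If `G` is a `p`-group of nilpotency class
`2` such that `p² ≤ |G : Z(G)| ≤ p³` then `ρ₀(G) = 1`"; printed proof: "by Proposition 2.17 `G`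
contains abelian (maximal, normal) subgroups of index `p`, and by [9, Corollary 4.3] `ρ₀(G) = 1`"):
for a group of order `pⁿ` whose centre has index `p²`, every subgroup TPP triple `(S, T, U)` has
`|S| |T| |U| ≤ |G|` (the class-2 hypothesis is then automatic).  This is the part of Thm. 5.1 whose
printed proof is valid; see `Murthy2026_thm51_index_pcubed_cyclic` for the valid half of the case
`[G : Z(G)] = p³`. [cite: Murthy2026, Thm. 5.1] [cite: Murthy2025TPPIndexP, Cor. 4.3 (2)] -/
theorem Murthy2026_thm51_index_psq {n : ℕ} (hG : Nat.card G = p ^ n)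
    (hZi : (Subgroup.center G).index = p ^ 2) {S T U : Subgroup G} (h : SubgroupTPP S T U) :
    Nat.card S * Nat.card T * Nat.card U ≤ Nat.card G := by
  obtain ⟨H, hHn, hHc, hHi⟩ := Murthy2026.exists_abelian_normal_index_p_of_index_center hZi
  haveI := hHn; haveI := hHc
  exact Murthy2025_cor43_2 H hp.out hHi hG h

/-- **Murthy 2026, Thm. 5.1, the case `[G : Z(G)] = p³` with `G/Z(G) ≅ C_{p²} × C_p`**: for a group of
order `pⁿ` of class `≤ 2` (`G/Z(G)` abelian) whose centre has index `p³` and such that `G/Z(G)` has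
an element of order `p²`, every subgroup TPP triple is trivial.  The remaining printed case
`G/Z(G) ≅ C_p³` has no valid printed proof (Prop. 2.17 (2) is false there, tree
`Murthy2026_prop217_2_false`); its statement is not decided in the tree.
[cite: Murthy2026, Thm. 5.1] [cite: Murthy2025TPPIndexP, Cor. 4.3 (2)] -/
theorem Murthy2026_thm51_index_pcubed_cyclic {n : ℕ} (hG : Nat.card G = p ^ n)
    (hZi : (Subgroup.center G).index = p ^ 3) (hQc : ∀ a b : G ⧸ Subgroup.center G, a * b = b * a)
    (hx : ∃ x : G ⧸ Subgroup.center G, orderOf x = p ^ 2) {S T U : Subgroup G}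
    (h : SubgroupTPP S T U) : Nat.card S * Nat.card T * Nat.card U ≤ Nat.card G := by
  obtain ⟨H, hHn, hHc, hHi⟩ := Murthy2026_prop217_2_cyclic hZi hQc hx
  haveI := hHn; haveI := hHc
  exact Murthy2025_cor43_2 H hp.out hHi hG h

end Literature.Computability.AlgebraicComplexity
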